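/-
Copyright (c) 2026. All rights reserved.
Released under Apache 2.0 license as described in the file LICENSE.
-/
import Summits.ValiantsHypothesis.ValiantsHypothesis.Theorems.ReadOnceColSparseSupport
import Summits.ValiantsHypothesis.ValiantsHypothesis.Theorems.ReadOnceCFIsolation
import HarnessLib

/-!
# Read-once determinants with column-sparse constants are hit by small definable families

The W4 isolation road one rung up from the constant-free slice (`ReadOnceCFIsolation`, rung 1):
READ-ONCE determinantal templates whose constants are ARBITRARY IN VALUE but COLUMN-SPARSE (every
column holds at most one non-zero constant; rows unrestricted), in ANY degree — including the
degenerate degrees `deg D < r` that the top-degree door (`TopDegreeDoor`, rung 1′) cannot see.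
Members: `det (A + diag c)` (all principal minors of a read-once matrix `A` at once), a constant
row over an `(r-1) × r` read-once matrix (a generic combination of its maximal minors),
`det (A + c • P)` for a partial permutation matrix `P`.
* The support of such a determinant is the set of monomials of the admissible permutations,
  WITHOUT CANCELLATION (unique completion, `ReadOnceColSparseSupport.monoOfO_mem_support`).
* `smallIsolatingWeights_colSparse`: S1's succinct hashing (`ReadOnceCFIsolation.oracle_inst`)
  serves the FREE-EDGE isolation rounds (`IsolationRoundsFree.exists_isolating_rounds_free`) on
  the partial labelling of the template (non-zero constants = free edges of weight `0`); the round
  circuits are juxtaposed by `RoundCircuits.exists_circuit_ofBits_eq_sum`; the parameter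
  bookkeeping is `ReadOnceCFSupport`'s, BY NAME.
* `readOnceColSparseDets_hit`: the rung, by the landed door `doorSpec_holds` BY NAME.
Currency: kernel-certified RUNG on the W4 road in the VNP column (`SmallDefinable`), over every
infinite field of characteristic `0`; the VP column (item 20152, `SmallCircuits ℂ`) and dense
constants in degenerate degree are untouched; closes no item; one data def
`readOnceColSparseDets`; no facts/doors. [cite: FennerGurjarThierauf2016, Theorem 3.1],
[cite: ForbesShpilkaVolk2018, §8].
-/

set_option linter.dupNamespace false

namespace Summit.ValiantsHypothesis.ValiantsHypothesis.Theorems.ReadOnceColSparseIsolation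

open MvPolynomial Literature.Barriers.ValiantsHypothesis
  Literature.Computability.AlgebraicComplexity Literature.Computability.Complexity CircuitArith
  BoolGadgets SuccinctTables SuccinctCirculationHashing IsolationRounds RoundCircuits
  ReadOnceCFIsolation IsolationRoundsFree ReadOnceColSparseSupport

section Main

variable (F : Type*) [Field F]

/-- READ-ONCE DETERMINANTS WITH COLUMN-SPARSE CONSTANTS of size `r ≤ binom(2n,n)^a` in the
coefficient variables.  This is the sub-family of the read-once determinants of item 20152
(`Theses/BarrierLever.lean` l.1335, `ReadOnceDeterminantsHitByVP : ∀ a, ∃ b n₀, ∀ n ≥ n₀,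
IsSuccinctHittingSet (degLEMonomials n) (SmallCircuits ℂ n b) {D | ∃ r E, r ≤ binom(2n,n)^a ∧
read-once ∧ D = (E.map (Sum.elim X C)).det}`) cut out by ONE extra clause — every column of the
template holds at most one NON-ZERO constant (values arbitrary, rows unrestricted) — and it is hit
here in the VNP column (`SmallDefinable`, not `SmallCircuits`) over every infinite field of
characteristic `0`.  It contains the constant-free slice `readOnceCFDets` (`readOnceCFDets_subset`)
and is incomparable with the variable-transversal slice `readOnceTDets`. [this file] -/
def readOnceColSparseDets (n a : ℕ) : Set (MvPolynomial (degLEMonomials n) F) :=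
  {D | ∃ (r : ℕ) (E : Matrix (Fin r) (Fin r) (degLEMonomials n ⊕ F)),
    r ≤ (Nat.choose (2 * n) n) ^ a ∧
    (∀ p q : Fin r × Fin r, ∀ m, E p.1 p.2 = Sum.inl m → E q.1 q.2 = Sum.inl m → p = q) ∧
    (∀ (j j' k : Fin r) (c c' : F), E j k = Sum.inr c → E j' k = Sum.inr c' → c ≠ 0 → c' ≠ 0 →
      j = j') ∧
    D = (E.map (Sum.elim MvPolynomial.X MvPolynomial.C)).det}

/-- **HEADLINE — small-circuit isolating weights for read-once determinants with column-sparse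
constants** (succinct FGT16 with free edges: S1 hashing as the oracle of the free-edge rounds on
the partial labelling of the template, the round circuits juxtaposed by S4c-i, support =
admissible permutations without cancellation by unique completion).
[cite: FennerGurjarThierauf2016, Theorem 3.1] (free-edge variant) -/
theorem smallIsolatingWeights_colSparse (a : ℕ) :
    ∃ c : ℕ, SmallIsolatingWeights F (fun n => readOnceColSparseDets F n a) c := by
  obtain ⟨c₁, n₁, hS1⟩ := exists_cktSize_circ_ne_zero 2
  refine ⟨c₁ + 5, max n₁ (8 * a + 4), fun n hn D hD hD0 => ?_⟩
  have hn₁ : n₁ ≤ n := (le_max_left _ _).trans hn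
  have hn8 : 8 * a + 4 ≤ n := (le_max_right _ _).trans hn
  obtain ⟨r, E, hr, hro, hcs, rfl⟩ := hD
  -- the oracle (S1 at level 2, weakened to exponent `c₁ + 1`, padded to width `B`)
  have hS1' : ∀ S : Finset (degLEMonomials n → ℤ), S.card ≤ 2 ^ n ^ 2 → (∀ π ∈ S, π ≠ 0) →
      (∀ π ∈ S, ∀ μ, (π μ).natAbs ≤ n) →
      ∃ (ℓ' : ℕ) (f : (Fin n × Fin (kBits n) → Bool) → Fin ℓ' → Bool), ℓ' ≤ n ^ (c₁ + 1) ∧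
        CktSize B2 f (n ^ (c₁ + 1)) ∧
        ∀ π ∈ S, circ (fun μ => Nat.ofBits (f (bitsOf μ))) π ≠ 0 := by
    intro S hS h0 hh
    obtain ⟨ℓ', f, hℓ', hf, hc⟩ := hS1 n hn₁ S hS h0 hh
    have hpow : n ^ c₁ ≤ n ^ (c₁ + 1) := Nat.pow_le_pow_right (by omega) (by omega)
    exact ⟨ℓ', f, hℓ'.trans hpow, hf.of_le hpow, hc⟩
  have horacle := oracle_inst (Nat.le_add_right (n ^ (c₁ + 1)) (2 * n * a)) (by omega)
    (ReadOnceCFSupport.card_bound hr hn8) hS1'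
  -- the free-edge rounds (`IsolationRoundsFree`) on the partial labelling of the template
  obtain ⟨T, ws, hT, hgood, -, σ, hσ, hiso⟩ :=
    exists_isolating_rounds_free (G₀ := fun k j => ∀ c : F, E j k = Sum.inr c → c ≠ 0)
      (lab := optLab E) (optLab_inj E hro) (optLab_free E hcs) horacle
      (exists_adm_of_det_ne_zero E hD0)
  choose fs hfs hws using hgood
  -- the circuit (S4c-i)
  obtain ⟨Q, out, hQ, hsize, hval⟩ := exists_circuit_ofBits_eq_sum
    ((⟨0, by omega⟩, ⟨0, by unfold kBits; omega⟩) : Fin n × Fin (kBits n)) fs hfs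
  have hW : ∀ μ : degLEMonomials n, weightOf Q out μ =
      ∑ t : Fin T, ws t μ * 2 ^ ((n ^ (c₁ + 1) + 2 * n * a) * (T - 1 - ↑t)) := by
    intro μ
    unfold weightOf
    rw [hval]
    simp_rw [hws]
  -- free positions weigh `0` under the combined weight as under every round weight
  have hW' : ∀ o : Option (degLEMonomials n), o.elim 0 (weightOf Q out) =
      ∑ t : Fin T, o.elim 0 (ws t) * 2 ^ ((n ^ (c₁ + 1) + 2 * n * a) * (T - 1 - ↑t)) := by
    intro o
    cases o with
    | none => simp
    | some μ => simpa using hW μ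
  have hsz := ReadOnceCFSupport.size_bound (c := c₁ + 1) (by omega) (by omega) (by omega)
    (hT.trans (ReadOnceCFSupport.rounds_bound hr))
  rw [show c₁ + 1 + 4 = c₁ + 5 from by omega] at hsz
  refine ⟨T * (n ^ (c₁ + 1) + 2 * n * a), Q, out, hQ, hsize.trans hsz,
    (Nat.le_add_left _ _).trans hsz, ?_⟩
  -- isolation of the survivor's monomial (no cancellation: unique completion)
  unfold IsolatesMin
  refine ⟨monoOfO (optLab E) σ, monoOfO_mem_support E hro hcs hσ, fun m hm hne => ?_⟩
  obtain ⟨τ, hτ, rfl⟩ := exists_perm_of_mem_support E hm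
  have hτσ : τ ≠ σ := fun h => hne (by rw [h])
  rw [sum_monoOfO, sum_monoOfO]
  simp_rw [hW']
  exact hiso _ (ReadOnceCFSupport.block_bound hr _) τ hτ hτσ

/-- **The census rung (W4, VNP column, any degree) for read-once determinants with column-sparse
constants**, by the landed door `doorSpec_holds` BY NAME. [cite: ForbesShpilkaVolk2018, §8] -/
theorem readOnceColSparseDets_hit [CharZero F] [Infinite F] (a : ℕ) :
    ∃ b n₀ : ℕ, ∀ n : ℕ, n₀ ≤ n → IsSuccinctHittingSet (degLEMonomials n) (SmallDefinable F n b)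
      (readOnceColSparseDets F n a) := by
  obtain ⟨c, hc⟩ := smallIsolatingWeights_colSparse F a
  exact doorSpec_holds F (fun n => readOnceColSparseDets F n a) c hc

/-- Rung 1 ⊆ rung 1″: constant-free read-once templates have column-sparse constants
(vacuously: they have no non-zero constant). [this file] -/
theorem readOnceCFDets_subset (n a : ℕ) : readOnceCFDets F n a ⊆ readOnceColSparseDets F n a := by
  rintro D ⟨r, E, hr, hro, hcf, rfl⟩
  exact ⟨r, E, hr, hro, fun j j' k c c' hc _ h0 _ => absurd (hcf j k c hc) h0, rfl⟩

end Main

end Summit.ValiantsHypothesis.ValiantsHypothesis.Theorems.ReadOnceColSparseIsolation
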